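import Literature.Probability.LatticeModels.SRWHeatKernelLCLT
import Literature.Probability.LatticeModels.LatticeGraph
import HarnessLib

/-!
# Time-continuity and product bounds for the planar heat kernels (inputs of the potential-kernel asymptotics)

Topic `Literature/Probability/LatticeModels`; small companion of `SRWHeatKernel1D.lean` /
`SRWHeatKernelLCLT.lean` collecting the elementary inputs of
`LatticePotentialKernelAsymptotics.lean` (`a(x) = (1/π) log|x| + κ + o(1)` for the planar
potential kernel): continuity of `t ↦ q_t(m)` and of `t ↦ φ_t(m)` (so that time integrals of
products can be split), the Gaussian identity `φ_t(0)² - φ_t(a)φ_t(b) = (2π)⁻¹(1 - e^{-σ/t})/t`,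
`σ = (a² + b²)/2`, the weight algebra `(1 + a²/t)⁻¹(1 + b²/t)⁻¹ ≤ (1 + (a²+b²)/t)⁻¹`,
`t⁻²(1 + s/t)⁻¹ ≤ t^{-3/2}/(2√s)`, and `x₀² + x₁² → ∞` along the cofinite filter of `ℤ²`.
Everything is proved, [folklore]; no named fact.
-/

noncomputable section

open MeasureTheory Set Filter Real
open scoped Topology

namespace Literature.Probability.LatticeModels

/-! ### Continuity in time and Gaussian algebra -/

/-- The heat kernel `q_t(m)` is continuous in `t` (a parametric integral over `[-π, π]` of a jointly
continuous integrand). [folklore] -/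
theorem continuous_srwHeatKernel_left (m : ℤ) : Continuous fun t : ℝ => srwHeatKernel t m := by
  unfold srwHeatKernel
  refine Continuous.div_const ?_ _
  have h : Continuous fun p : ℝ × ℝ => Real.cos (p.2 * m) * Real.exp (-(p.1 * (1 - Real.cos p.2))) := by
    fun_prop
  exact intervalIntegral.continuous_parametric_intervalIntegral_of_continuous' h (-π) π

/-- The Gaussian kernel `φ_t(m)` is continuous in `t` on `(0, ∞)`. [folklore] -/
theorem continuousOn_gaussHeatKernel_left (m : ℝ) :
    ContinuousOn (fun t : ℝ => gaussHeatKernel t m) (Ioi 0) := by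
  unfold gaussHeatKernel
  refine ContinuousOn.div ?_ ?_ fun t ht => ?_
  · exact Real.continuous_exp.comp_continuousOn
      ((continuousOn_const.div (continuousOn_const.mul continuousOn_id)
        fun t ht => mul_ne_zero two_ne_zero (ne_of_gt ht)).neg)
  · exact (Real.continuous_sqrt.comp (continuous_const.mul continuous_id)).continuousOn
  · have ht' : (0 : ℝ) < t := ht
    exact Real.sqrt_ne_zero'.2 (by have := Real.pi_pos; positivity)

/-- `φ_t(0)² - φ_t(a) φ_t(b) = (2π)⁻¹ (1 - e^{-σ/t})/t` with `σ = (a² + b²)/2`, for `t > 0`.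
[folklore] -/
theorem gaussHeatKernel_sq_sub_mul {t : ℝ} (ht : 0 < t) (a b : ℝ) :
    gaussHeatKernel t 0 ^ 2 - gaussHeatKernel t a * gaussHeatKernel t b =
      (2 * π)⁻¹ * ((1 - Real.exp (-(((a ^ 2 + b ^ 2) / 2) / t))) / t) := by
  have hπ := Real.pi_pos
  have h2πt : 0 < 2 * π * t := by positivity
  have hsq : Real.sqrt (2 * π * t) ^ 2 = 2 * π * t := Real.sq_sqrt h2πt.le
  have hsqrt0 : Real.sqrt (2 * π * t) ≠ 0 := Real.sqrt_ne_zero'.2 h2πt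
  unfold gaussHeatKernel
  rw [div_mul_div_comm, ← Real.exp_add, ← pow_two, hsq, div_pow, hsq]
  simp only [ne_eq, OfNat.ofNat_ne_zero, not_false_eq_true, zero_pow, zero_div, neg_zero,
    Real.exp_zero, one_pow]
  rw [show -(a ^ 2 / (2 * t)) + -(b ^ 2 / (2 * t)) = -(((a ^ 2 + b ^ 2) / 2) / t) by
    field_simp; ring]
  field_simp

/-! ### Kernel bounds on `(1, ∞)` -/

/-- The constant `C = 2·1!·e^{1/2}` of `gaussHeatKernel_le_weight 1`. [folklore] -/
theorem gaussHeatKernel_le_weight_one {t : ℝ} (ht : 0 < t) (m : ℝ) :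
    gaussHeatKernel t m ≤ (2 * Real.exp (1 / 2)) * t ^ (-(1 / 2 : ℝ)) * ((1 + m ^ 2 / t) ^ 1)⁻¹ := by
  have h := gaussHeatKernel_le_weight 1 ht m
  simpa using h

/-- Weights are at most one: `((1 + m²/t)^1)⁻¹ ≤ 1` for `t > 0`. [folklore] -/
theorem weight_le_one {t : ℝ} (ht : 0 < t) (m : ℝ) : ((1 + m ^ 2 / t) ^ 1)⁻¹ ≤ 1 := by
  rw [pow_one]
  exact inv_le_one_of_one_le₀ (le_add_of_nonneg_right (by positivity))

/-- Product of the two coordinate weights against the radial weight: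
`(1 + a²/t)⁻¹ (1 + b²/t)⁻¹ ≤ (1 + (a² + b²)/t)⁻¹`. [folklore] -/
theorem weight_mul_weight_le {t : ℝ} (ht : 0 < t) (a b : ℝ) :
    ((1 + a ^ 2 / t) ^ 1)⁻¹ * ((1 + b ^ 2 / t) ^ 1)⁻¹ ≤ (1 + (a ^ 2 + b ^ 2) / t)⁻¹ := by
  rw [pow_one, pow_one, ← mul_inv]
  have ha : 0 ≤ a ^ 2 / t := by positivity
  have hb : 0 ≤ b ^ 2 / t := by positivity
  refine inv_anti₀ (by positivity) ?_
  rw [add_div]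
  nlinarith

/-- `t⁻² (1 + s/t)⁻¹ ≤ t^{-3/2} / (2√s)` for `t > 0`, `s > 0` (`t + s ≥ 2√(ts)`). [folklore] -/
theorem rpow_neg_two_mul_inv_le {t s : ℝ} (ht : 0 < t) (hs : 0 < s) :
    t ^ (-(2 : ℝ)) * (1 + s / t)⁻¹ ≤ t ^ (-(3 / 2 : ℝ)) / (2 * Real.sqrt s) := by
  have hst : 2 * Real.sqrt t * Real.sqrt s ≤ t + s := by
    nlinarith [sq_nonneg (Real.sqrt t - Real.sqrt s), Real.sq_sqrt ht.le, Real.sq_sqrt hs.le]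
  have hsq : 0 < Real.sqrt s := Real.sqrt_pos.2 hs
  have htq : 0 < Real.sqrt t := Real.sqrt_pos.2 ht
  -- rewrite both sides with `√t` and powers of `t`
  have h1 : t ^ (-(2 : ℝ)) * (1 + s / t)⁻¹ = (t * (t + s))⁻¹ := by
    rw [Real.rpow_neg ht.le, show (2 : ℝ) = (2 : ℕ) by norm_num, Real.rpow_natCast, ← mul_inv]
    congr 1
    field_simp
  have h2 : t ^ (-(3 / 2 : ℝ)) = (t * Real.sqrt t)⁻¹ := by
    rw [Real.rpow_neg ht.le, show (3 / 2 : ℝ) = 1 + 1 / 2 by norm_num, Real.rpow_add ht,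
      Real.rpow_one, ← Real.sqrt_eq_rpow]
  rw [h1, h2, div_eq_mul_inv, ← mul_inv]
  refine inv_anti₀ (by positivity) ?_
  calc t * Real.sqrt t * (2 * Real.sqrt s) = t * (2 * Real.sqrt t * Real.sqrt s) := by ring
    _ ≤ t * (t + s) := by gcongr

/-! ### Divergence of the radius along the cofinite filter -/

/-- `x₀² + x₁² → ∞` along the cofinite filter of `ℤ²`. [folklore] -/
theorem tendsto_sum_sq_cofinite :
    Tendsto (fun x : Site 2 => ((x 0 : ℤ) : ℝ) ^ 2 + ((x 1 : ℤ) : ℝ) ^ 2) cofinite atTop := by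
  rw [tendsto_atTop]
  intro N
  rw [Filter.eventually_cofinite]
  obtain ⟨n, hn⟩ := exists_nat_ge N
  refine (Set.Finite.pi (t := fun _ : Fin 2 => Set.Icc (-(n : ℤ)) n)
    (fun _ => Set.finite_Icc _ _)).subset ?_
  intro x hx
  simp only [Set.mem_setOf_eq, not_le] at hx
  simp only [Set.mem_pi, Set.mem_univ, Set.mem_Icc, forall_const]
  have key : ∀ i : Fin 2, ((x i : ℤ) : ℝ) ^ 2 < n := by
    have h0 : 0 ≤ ((x 0 : ℤ) : ℝ) ^ 2 := sq_nonneg _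
    have h1 : 0 ≤ ((x 1 : ℤ) : ℝ) ^ 2 := sq_nonneg _
    have hlt : ((x 0 : ℤ) : ℝ) ^ 2 + ((x 1 : ℤ) : ℝ) ^ 2 < n := lt_of_lt_of_le hx hn
    intro i
    fin_cases i
    · show ((x 0 : ℤ) : ℝ) ^ 2 < n
      linarith
    · show ((x 1 : ℤ) : ℝ) ^ 2 < n
      linarith
  intro i
  have hn0 : (0 : ℝ) ≤ n := n.cast_nonneg
  have h2 : ((x i : ℤ) : ℝ) ^ 2 < ((n : ℝ) + 1) ^ 2 := by nlinarith [key i]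
  have h3 : |((x i : ℤ) : ℝ)| < n + 1 := abs_lt_of_sq_lt_sq h2 (by positivity)
  have h4 : |x i| < (n : ℤ) + 1 := by exact_mod_cast h3
  rw [abs_lt] at h4
  omega

end Literature.Probability.LatticeModels
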